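import Summits.BirchSwinnertonDyer.BirchSwinnertonDyer.Theorems.SignedLowerHalvesKobayashiLowerHalfSemistablePW21FixedIdeals
import Literature.NumberTheory.Automorphic.DefiniteOrderUnitsTorsion
import Literature.NumberTheory.Automorphic.BrandtEigenvectorNonEisenstein
import Literature.NumberTheory.EllipticCurves.NonEisensteinPrimeOfSurjective
import Literature.NumberTheory.EllipticCurves.PollackWestonUnitPairing
import HarnessLib

/-!
# Stub `stub_pollackWestonLemma21` of line «defmu», crux 2 `KobayashiLowerHalfSemistable` (stmt-BirchSwinnertonDyer-19000) —
# part 3/3: Pollack–Weston 2011, Lemma 2.1 PROVED (the named fact `pollackWeston2011_lemma21_exists_not_dvd_weight_mul`)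

Route-independent `Theorems` file (cell `b2b-bsdres`, seat `b2b-bsdres-x10b` = class owner X6, gen 41); part 3 of the series
(parts 1/2: `…PW21CubeRoots.lean`, `…PW21FixedIdeals.lean`).
HONEST FRAMING: prove what is provable now; shrink each hard class to its core with data; no claim beyond stated
classes. Nothing about any curve is asserted and NO summit statement is proved here; BSD is not proved by any of this.
What IS proved: the registered stub `stub_pollackWestonLemma21` of skeleton «defmu» v6 (LEAD bsd-line-slh-p2 g18), VERBATIM —
its signature is the body of the Literature named fact `pollackWeston2011_lemma21_exists_not_dvd_weight_mul`
(`Literature/NumberTheory/EllipticCurves/PollackWestonUnitPairing.lean`; Pollack–Weston, Compos. Math. 147 (2011), §2.1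
Lemma 2.1: "There is some `m ∈ ℳ` such that `⟨m, g_f⟩` is a unit"; in the tree's coordinates `∃ c, p ∤ w_c φ_c` for the
generator `φ` of the `a(E)`-eigen-line of the Brandt module of a setup of type `(N⁺, N⁻)` and Gross's weights `w_c`, under
`p` odd and `ρ̄_{E,p}` surjective), previously an input cited BY NAME; now a kernel theorem (`pollackWeston2011_lemma21_holds`).

The printed proof ("follows from [T]" = Takahashi 2001, via Kohel's isomorphism with a character group, Prop. 6.5) is
replaced by an argument inside the Brandt module which uses only CR (i) (`ρ̄_{E,p}` irreducible) of the fact's hypotheses —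
the ramification condition at `q ∣ N⁻`, the square-freeness of `N⁺N⁻` and the oddness of `p` are idle:

1. `φ` is primitive (`Brandt.exists_not_dvd_of_eigenLattice_eq_span`): `p ∤ φ_c₀` for some `c₀`. If every
   `w_c φ_c ≡ 0 (mod p)` then `p ∣ w_c₀`; as `w_c ∣ 12` (`XiSetup.not_dvd_weight`), `p = 3`.
2. For every prime `ℓ ∤ N⁺N⁻` and every class `c` with `3 ∣ w_c`, the Brandt column `T(ℓ)_·c` is `≡ (ℓ + 1) e_c (mod 3)`:
   off the diagonal by `three_dvd_matrix_of_dvd_weight` (part 2), on the diagonal because the column sums to `ℓ + 1`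
   (`XiSetup.sum_matrix_prime_eq`, Eichler).
3. Reading the `c₀`-coordinate of `T(ℓ) φ = a_ℓ(E) φ` modulo `3` (the classes `c` with `3 ∤ w_c` have `3 ∣ φ_c`):
   `a_ℓ(E) φ_c₀ ≡ (ℓ + 1) φ_c₀`, so `a_ℓ(E) ≡ ℓ + 1 (mod 3)` for EVERY prime `ℓ ∤ N⁺N⁻ = N_E` — contradicting the
   non-Eisenstein good prime that surjectivity of `ρ̄_{E,3}` provides
   (`exists_prime_not_dvd_lFunction_sub_of_hasSurjectiveModNGaloisRep`).

## References

* [PollackWeston2011] R. Pollack, T. Weston, *On anticyclotomic μ-invariants of modular forms*, Compos. Math. 147 (2011)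
  1353–1381, §2.1 Lemma 2.1 and §6.3 (arXiv:math/0610694 pp. 5, 15).
* [Gross1987] B. H. Gross, *Heights and the special values of L-series* (1987), §§1–3.
* [DarmonDiamondTaylor1995] H. Darmon, F. Diamond, R. Taylor, *Fermat's Last Theorem* (1995), Prop. 2.6(b).
-/

noncomputable section

-- D-0017: single-problem summit, the namespace repeats the problem name by design.
set_option linter.dupNamespace false

namespace Summit.BirchSwinnertonDyer.BirchSwinnertonDyer.Theorems.PollackWestonLemma21

open Literature.NumberTheory.EllipticCurves Literature.NumberTheory.Automorphic Brandt


/-- **Pollack–Weston 2011, Lemma 2.1 — PROVED** (discharge of the named fact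
`pollackWeston2011_lemma21_exists_not_dvd_weight_mul`): under `p` odd, `ρ̄_{E,p}` surjective, and
the Brandt/eigen-line set-up of the fact, some `w_c φ_c` is prime to `p`. Proof (Brandt module only;
the ramification hypothesis at `q ∣ N⁻` is not used): the generator `φ` is primitive, so `p ∤ φ_{c₀}`
for some `c₀`; if every `w_c φ_c ≡ 0 (mod p)` then `p ∣ w_{c₀}`, forcing `p = 3` (`w_c ∣ 12`); the
classes `c` with `3 ∣ w_c` have Brandt columns `T(ℓ)_{·c} ≡ (ℓ + 1) e_c (mod 3)` at every prime
`ℓ ∤ N⁺N⁻` (`XiSetup.three_dvd_matrix_of_dvd_weight` and the column sum `ℓ + 1`), so the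
`c₀`-coordinate of `T(ℓ) φ = a_ℓ(E) φ` gives `a_ℓ(E) ≡ ℓ + 1 (mod 3)` for all such `ℓ` — contradicting
the non-Eisenstein prime supplied by surjectivity
(`exists_prime_not_dvd_lFunction_sub_of_hasSurjectiveModNGaloisRep`).
[cite: PollackWeston2011, §2.1 Lemma 2.1; proof in §6.3 via Prop. 6.5 (arXiv:math/0610694 pp. 5, 15)] -/
theorem pollackWeston2011_lemma21_holds :
    pollackWeston2011_lemma21_exists_not_dvd_weight_mul := by
  intro p _ W _ _ Nplus Nminus S _ hp2 hN hsq hpN hsurj hram φ hφ0 hφ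
  classical
  have hp : p.Prime := Fact.out
  by_contra hall
  push Not at hall
  -- a primitive coordinate `c₀`: `p ∤ φ_{c₀}`, hence `p ∣ w_{c₀}`
  obtain ⟨c₀, hc₀⟩ := exists_not_dvd_of_eigenLattice_eq_span hφ0 hφ hp
  have hpZ : Prime (p : ℤ) := Nat.prime_iff_prime_int.mp hp
  have hpw : p ∣ weight S.O c₀ := by
    have := (hpZ.dvd_or_dvd (hall c₀)).resolve_right hc₀
    exact_mod_cast this
  -- `p = 3`
  have hp3 : p = 3 := by
    by_contra h3
    have h5 : 5 ≤ p := by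
      have h2 := hp.two_le
      rcases Nat.lt_or_ge p 5 with hlt | hge
      · interval_cases p <;> simp_all (config := {decide := true})
      · exact hge
    exact S.not_dvd_weight c₀ hp h5 hpw
  subst hp3
  -- a non-Eisenstein good prime `ℓ`
  obtain ⟨ℓ, hℓ, -, hℓN, hℓa⟩ :=
    exists_prime_not_dvd_lFunction_sub_of_hasSurjectiveModNGaloisRep W 3 hsurj
  have hℓNN : ¬ ℓ ∣ Nplus * Nminus := by rw [hN]; exact hℓN
  apply hℓa
  -- the eigen-equation at `ℓ`, coordinate `c₀`
  have hmem : φ ∈ eigenLattice (Nplus * Nminus) (matrix S.O) (fun n => W.LFunction n) :=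
    hφ ▸ Submodule.mem_span_singleton_self φ
  have heig := (mem_eigenLattice_iff.mp hmem) ℓ hℓ hℓNN
  have hc : ∑ j, matrix S.O ℓ c₀ j * φ j = W.LFunction ℓ * φ c₀ := by
    have := congr_fun heig c₀
    simpa [Matrix.mulVec, dotProduct] using this
  -- off-diagonal terms of row `c₀` are divisible by `3`
  have hterm : ∀ j ∈ Finset.univ.erase c₀, (3 : ℤ) ∣ matrix S.O ℓ c₀ j * φ j := by
    intro j hj
    have hjc : j ≠ c₀ := Finset.ne_of_mem_erase hj
    by_cases h3 : 3 ∣ weight S.O j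
    · exact (three_dvd_matrix_of_dvd_weight S hℓ hℓNN hjc.symm h3).mul_right _
    · have h3' : ¬ ((3 : ℕ) : ℤ) ∣ (weight S.O j : ℤ) := fun h => h3 (by exact_mod_cast h)
      exact ((hpZ.dvd_or_dvd (hall j)).resolve_left h3').mul_left _
  -- the diagonal entry is `≡ ℓ + 1 (mod 3)` (column sum `ℓ + 1`, column `c₀` has `3 ∣ w_{c₀}`)
  have hdiag : (3 : ℤ) ∣ matrix S.O ℓ c₀ c₀ - (ℓ + 1) := by
    have hsum := S.sum_matrix_prime_eq hℓ hℓNN c₀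
    rw [← Finset.add_sum_erase _ _ (Finset.mem_univ c₀)] at hsum
    have : matrix S.O ℓ c₀ c₀ - (ℓ + 1) = -∑ i ∈ Finset.univ.erase c₀, matrix S.O ℓ i c₀ := by
      linarith
    rw [this]
    exact (Finset.dvd_sum fun i hi =>
      three_dvd_matrix_of_dvd_weight S hℓ hℓNN (Finset.ne_of_mem_erase hi) hpw).neg_right
  have hkey : (3 : ℤ) ∣ (W.LFunction ℓ - (ℓ + 1)) * φ c₀ := by
    have : (W.LFunction ℓ - (ℓ + 1)) * φ c₀ =
        (∑ j ∈ Finset.univ.erase c₀, matrix S.O ℓ c₀ j * φ j) + (matrix S.O ℓ c₀ c₀ - (ℓ + 1)) * φ c₀ := by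
      rw [sub_mul, ← hc, ← Finset.add_sum_erase _ _ (Finset.mem_univ c₀)]
      ring
    rw [this]
    exact dvd_add (Finset.dvd_sum hterm) (hdiag.mul_right _)
  exact ((Nat.prime_iff_prime_int.mp Nat.prime_three).dvd_or_dvd hkey).resolve_right hc₀


/-- **The registered stub `stub_pollackWestonLemma21` of skeleton «defmu» v6 (crux 2, stmt-BirchSwinnertonDyer-19000),
signature VERBATIM, PROVED** — it is the body of the named fact, so this is `pollackWeston2011_lemma21_holds` unfolded.
[cite: PollackWeston2011, §2.1 Lemma 2.1] -/
theorem stub_pollackWestonLemma21 :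
    ∀ (p : ℕ) [Fact p.Prime] (W : WeierstrassCurve ℚ) [W.IsElliptic] [W.IsGloballyMinimal]
      {Nplus Nminus : ℕ} (S : Brandt.XiSetup Nplus Nminus) [Fintype (Brandt.ClassSet S.O)],
      p ≠ 2 → Nplus * Nminus = W.conductorNorm ℤ → Squarefree (Nplus * Nminus) → ¬ p ∣ Nplus * Nminus →
      Rank1Residual.Surj W p → (∀ q : ℕ, q.Prime → q ∣ Nminus → ¬ ((p : ℤ) ∣ padicValRat q W.Δ)) →
      ∀ (φ : Brandt.ClassSet S.O → ℤ), φ ≠ 0 →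
        Brandt.eigenLattice (Nplus * Nminus) (Brandt.matrix S.O) (fun n => W.LFunction n) = ℤ ∙ φ →
        ∃ c : Brandt.ClassSet S.O, ¬ (p : ℤ) ∣ (Brandt.weight S.O c : ℤ) * φ c :=
  pollackWeston2011_lemma21_holds

end Summit.BirchSwinnertonDyer.BirchSwinnertonDyer.Theorems.PollackWestonLemma21

end
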